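import Summits.QuantumFields.YangMills.Theorems.BalabanUVNodesN22W1LocatedRecordsWitness
import Literature.MathematicalPhysics.QuantumFieldTheory.Balaban1983to89.Node00.HistoryAdmissibleClass
import Literature.MathematicalPhysics.QuantumFieldTheory.Balaban1983to89.T4Continuum

/-!
# BalabanUVNodes ∕ node N22 = NE9 — MODULE J88-Wb: THE FOUR DATUM-SIDE BINDERS `hlaw ∕ hBox ∕ hχ1 ∕ hιc` OF THE SOCKETS OF RECORD, AS STATED THERE
# (a term-data FAMILY over the record's parameter tower `F.P K`, the socket's own antecedent `old ∈ AdmHist ∧ old 0 = 0`, `φ ∈ sp`, `Z ⊆ X`,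
# `s ∈ terms`, `t ∈ ]0, γ]`), ARE JOINTLY INHABITED — module J88-W read at the binder level of J89 ∕ J81s (LEMMA 2's SENTENCE edition) and J88 ∕ J81r

Cell `pub-ymgap`, HUMAN RULING D-0062 (Track A), R134 seat `pub-ymgap-dag-n22-c` (strategy s1), generation 22, module J88-Wb.  THEOREMS ONLY (no `def`, no
`sorry`, standard axioms); `--kind proof --supports stmt-QuantumFields-27366 --as helper` (K3⁸), COUNT-NEUTRAL.  Imports this lane's module J88-W
`…N22W1LocatedRecordsWitness` (the per-step witness `locatedLemma2Records_inhabited ∕ locatedRecords_inhabited` at node00-def-W1's degenerate datum) and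
node00-def-W1's `Node00/HistoryAdmissibleClass` (`W1.AdmHist`, the sockets' admissible-history class) ∕ `T4Continuum` (`T4Family`).  Nothing re-declared.

WHY ∕ WHAT.  Module J88-W states its witness PER STEP (`𝔇 : TermDatum214 c P 𝔸 M k L`, one parameter record `P`, `∀ Z, 1 ≤ |Z| → ∀ s old φ t, 0 < t → …`);
the sockets of record bind a term-data FAMILY `𝔇 : (K : ℕ) → TermData214 c₀ (F.P K) 𝔸 M L` over the record's parameter tower, the FAMILY law
`(𝔇 K).UnscaledFieldLawOn (χu K) (χcu K) (𝒲 K) (𝒪 K) γ`, and a located family `hιc` whose antecedent is the socket's own (`old ∈ AdmHist (sp K) E₀ r₁ k ∧ old 0 = 0`,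
`φ ∈ sp K (k+1) X`, `Z ⊆ X`, `s ∈ terms L M Z`, `t ∈ Ioc 0 γ`).  Referee ref-F READ-780 (p702129) checked J88-W's body against J89's `hιc` by TOKEN DIFF «identical modulo
`(𝔇 K k) ↦ 𝔇`, `χu K k ↦ χu`, …, `ρb ↦ 1∕12`, `a₅ ↦ 2`» and flagged the re-check for J89's reader.  THIS FILE makes it KERNEL-CHECKED: the conclusions below are the
binder types of the tree's J89 (`…TermDataTableGermsLocatedRadiiMembersOfLemma2Records`, binders `hlaw hBox hχ1 hιc`) resp. J88 (`…MembersOfLocatedRecords`) copied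
VERBATIM with exactly the substitutions `ρb ↦ (1∕12 : ℝ)`, `a₅ ↦ 2`, `θ.γ ↦ γ` — family built from J88-W by choice over `(K, k)`, the socket's antecedent discharged
trivially, `1 ≤ |Z|` from the torus-domain type (`TDom` = nonempty face-connected finsets: `Z.2.1`).
* §1 ★ `socketFamilies_inhabited_lemma2` — J89 ∕ J81s's `hlaw ∧ hBox ∧ hχ1 ∧ hιc` (Lemma 2's sentence `AnalyticGrowthInputs`).
* §2 ★ `socketFamilies_inhabited_localGrowth` — J88 ∕ J81r's `hlaw ∧ hBox ∧ hχ1 ∧ hιc` (local growth record `LocalGrowthInputs`).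

HONEST FRAMING (binding).  An A2 ∕ A6 CONSISTENCY witness of FOUR displayed binders of the sockets AT DEGENERATE DATA (J88-W's datum: free kernels, zero complex
potentials, indicator boxes — NOT Bałaban's objects), at the witness's numerics `ρ_b = 1∕12`, `a₅ = 2`; the sockets' OTHER hypotheses (N18's rate, (1.21), W1-20's law,
NODE A's `hι ∕ hloc18` at the datum OF RECORD, the reading laws, the chart block, `Lemma3Numerics` and the capstone numerics) are NOT touched and NO joint inhabitant of a
whole socket antecedent is claimed.  Nothing of Bałaban's asserted; N22 NOT discharged; K3⁸ untouched; counts unmoved; one finite 𝕋⁴ programme at fixed ε — NOTHING about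
the continuum limit, ℝ⁴, infinite volume, OS axioms, a mass gap or the Clay problem.
References (TYPES only): [II] = Bałaban, CMP 116 (1988) (2.3) p. 12, (2.14) p. 15, (2.16)–(2.22) p. 16, (2.23)–(2.26) p. 17, Lemma 2 p. 11, (1.34) p. 9; [I] = CMP 109 (1987)
§1 p. 263 ((1.18) and the admissible class), (2.9)–(2.13) pp. 266–268.
-/

noncomputable section

namespace YMDAG.N22.W1

open Set Metric Matrix
open scoped BigOperators
open Literature.MathematicalPhysics.QuantumFieldTheory.Balaban1983to89
open Literature.MathematicalPhysics.QuantumFieldTheory.Balaban1983to89.T4Continuum (T4Family)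
open Literature.MathematicalPhysics.QuantumFieldTheory.Balaban1983to89.TreeLengthTorus (TPt TDom tsys)
open Literature.MathematicalPhysics.QuantumFieldTheory.Balaban1983to89.B9Thm37GlueTorus (tdist1)
open Literature.MathematicalPhysics.QuantumFieldTheory.Balaban1983to89.B12TreeDecay (K₀)
open Literature.MathematicalPhysics.QuantumFieldTheory.Balaban1983to89.B13Lemma3TorusTerms (terms)
open Literature.MathematicalPhysics.QuantumFieldTheory.Balaban1983to89.Node00.Sect2 (domSys domCount CPair)
open Literature.MathematicalPhysics.QuantumFieldTheory.Balaban1983to89.Node00.W1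

variable (F : T4Family) {𝔸 : Type*} [NormedRing 𝔸] [NormedAlgebra ℂ 𝔸] (M L : ℕ) [NeZero M] [NeZero L] {c : B13.Consts}

/-! ## §1 ★ J89 ∕ J81s: the family law, the box laws, `χᵘχᶜᵘ ≤ 1` and the located family in LEMMA 2's currency — jointly inhabited as stated -/

open Classical in
/-- ★ **THE DATUM-SIDE BINDERS `hlaw ∧ hBox ∧ hχ1 ∧ hιc` OF THE LEMMA-2-CURRENCY SOCKETS (J89 ∕ J81s) ARE JOINTLY INHABITED, AS STATED** — for every parameter
tower `F`, block sizes `M, L`, every `c` with W1-8's elementary conditions, every table `sp`, admissibility letters `E₀, r₁`, window `γ`, weight letter `a` and `Mv > 1`: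
a term-data family `𝔇 : (K : ℕ) → TermData214 c (F.P K) 𝔸 M L` with readings `χᵘ χᶜᵘ 𝒲 𝒪` such that the FAMILY law on `]0, γ]`, the box laws, `χᵘχᶜᵘ ≤ 1` hold and the
located family of J89 (binder `hιc` verbatim at `ρ_b = 1∕12`, `a₅ = 2`: per step, admissible history with `old 0 = 0`, `φ ∈ sp`, `Z ⊆ X`, `s ∈ terms`, `t ∈ ]0, γ]` ONE
`Inputs226Holo` record, ONE `AnalyticGrowthInputs` record and the rows (r1)–(r6)) is inhabited — J88-W §1 step by step (the antecedent is not used: the witness serves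
every `Z, s, old, φ, t > 0`; `1 ≤ |Z|` holds on the torus-domain type).  A6 witness at degenerate data; nothing of print's.
[cite: Balaban1988RG2Cluster, (2.3) p.12, (2.14) p.15 and (2.22) p.16 (degenerate data; bookkeeping)] -/
theorem socketFamilies_inhabited_lemma2 (hκ₁ : 1 ≤ c.κ₁) (hE : 0 < c.E₀) (hε : 0 < c.ε₁) (hC₁ : 0 < c.C₁) (hα : 0 < c.α₄) (hMc : 0 < c.M)
    (hδκ : 0 ≤ (1 - 3 * c.δ) * c.κ) (hpref : c.E₀ * c.ε₁ * c.C₁ * c.α₄⁻¹ * c.M ^ c.q * Real.exp (c.C₂ * c.κ₁) ≤ 1 / 2)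
    (sp : (K j : ℕ) → (domSys (F.P K) M j).Dom → Set (CPair (F.P K) 𝔸)) (E₀ r₁ γ a : ℝ) {Mv : ℝ} (hMv : 1 < Mv) :
    ∃ (𝔇 : (K : ℕ) → TermData214 c (F.P K) 𝔸 M L) (χu χcu : (K k : ℕ) → (𝔇 K k).UnscaledChi) (𝒲 : (K k : ℕ) → (𝔇 K k).UnscaledWilson)
      (𝒪 : (K k : ℕ) → (𝔇 K k).UnscaledOlder),
      (∀ K, (𝔇 K).UnscaledFieldLawOn (χu K) (χcu K) (𝒲 K) (𝒪 K) γ) ∧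
      (∀ (K k : ℕ) (Z : (domSys (F.P K) M (k + 1)).Dom) (s : TermLabel (F.P K) M k L), (𝔇 K k).UnscaledBoxLaws (χu K k) (χcu K k) Z s) ∧
      (∀ (K k : ℕ) (Z : (domSys (F.P K) M (k + 1)).Dom) (s : TermLabel (F.P K) M k L) (A : ((𝔇 K k).𝒦 Z s).Λ → ℝ), χu K k Z s A * χcu K k Z s A ≤ 1) ∧
      (∀ (K k : ℕ) (old : OlderTerms (F.P K) 𝔸 M k), old ∈ AdmHist (sp K) E₀ r₁ k ∧ old 0 = 0 → ∀ (X : (domSys (F.P K) M (k + 1)).Dom), ∀ φ ∈ sp K (k + 1) X,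
      ∀ Z : (domSys (F.P K) M (k + 1)).Dom, Subtype.val Z ⊆ Subtype.val X → ∀ s ∈ terms L M Z, ∀ t ∈ Ioc (0 : ℝ) γ,
        ∃ ι : (𝔇 K k).Inputs226Holo c Z s ((t : ℝ) : ℂ) old φ a 2, ∃ ag : (𝔇 K k).AnalyticGrowthInputs (χu K k) (𝒲 K k) (𝒪 K k) Z s old φ ι.Uτ,
        ∃ KE KG' KCs' θΓ' θC' θE' am wm δ : ℝ,
          0 ≤ KE ∧
          (∀ b b', ‖(((𝔇 K k).𝒦 Z s).C⁻¹.map (algebraMap ℝ ℂ)) b b'‖ ≤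
            KE * Real.exp (-(ι.kap * tdist1 (𝔇 K k).Nf (((𝔇 K k).𝒦 Z s).locΛ b) (((𝔇 K k).𝒦 Z s).locΛ b')))) ∧
          (1 + (1 / 12 : ℝ)) * ι.KG ≤ KG' ∧ ((1 - (1 / 12 : ℝ)) ^ 2)⁻¹ * ι.KCs ≤ KCs' ∧ ι.θΓ + (1 / 12 : ℝ) * ι.KG ≤ θΓ' ∧
          ι.θC + (1 / 12 : ℝ) * (2 + (1 / 12 : ℝ)) * ((1 - (1 / 12 : ℝ)) ^ 2)⁻¹ * ι.KCs ≤ θC' ∧ ι.θE + (1 / 12 : ℝ) * (2 + (1 / 12 : ℝ)) * (ι.θE + KE) ≤ θE' ∧ θE' ≤ ι.θ ∧ θΓ' ≤ ι.θ ∧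
          ((((𝔇 K k).𝒦 Z s).m * (1 + 2 / (ι.kap - ι.kap')) ^ (𝔇 K k).ν) * (((𝔇 K k).𝒦 Z s).m * (1 + 2 / (ι.kap' - ι.kap'')) ^ (𝔇 K k).ν)
            * (θΓ' * KCs' * KG' + ι.KΓ * θC' * KG' + ι.KΓ * ι.K₀ * θΓ') ≤ ι.θ) ∧
          (1 + (1 / 12 : ℝ)) ^ 2 * (2 * ag.ρ * (ag.Cp * K₀ (4 * 2 ^ (F.P K).d) (2 * (F.P K).d))) ≤ am ∧ (1 + (1 / 12 : ℝ)) ^ 2 * (∑ Y ∈ s.1, ag.Rτ Y * (ag.M𝒪 Y + (2 * ag.M𝒪 Y / ag.R) * ag.ρ)) ≤ wm ∧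
          0 < δ ∧ 2 * δ + 8 * ag.ρ * (ag.Cp * K₀ (4 * 2 ^ (F.P K).d) (2 * (F.P K).d)) ≤ am ∧
          Real.exp (∑ Y ∈ s.1, ag.Rτ Y * ag.M𝒪 Y)
              * ((∑ Y ∈ s.1, ag.Rτ Y * ((4 * (2 * ag.M𝒲 Y / ag.R ^ 4) + (4 * (ag.M𝒲 Y / ag.R ^ 3) + 4 * (ag.M𝒲 Y / ag.R ^ 3)) / ag.ρ) * (4 / (Real.exp 1 * δ)) ^ 4
                    + ((4 * ag.M𝒪 Y / ag.R ^ 2) + ((2 * ag.M𝒪 Y / ag.R) + (2 * ag.M𝒪 Y / ag.R)) / ag.ρ) * (2 / (Real.exp 1 * δ)) ^ 2)) * Real.exp (δ / 2)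
                 + ((∑ Y ∈ s.1, ag.Rτ Y * (4 * (ag.M𝒲 Y / ag.R ^ 3) * (3 / (Real.exp 1 * δ)) ^ 3 + (2 * ag.M𝒪 Y / ag.R) * (1 / (Real.exp 1 * δ))))
                      * Real.exp (δ / 2)) ^ 2
                    * Real.exp ((∑ Y ∈ s.1, ag.Rτ Y * (ag.M𝒪 Y + (2 * ag.M𝒪 Y / ag.R) * ag.ρ)) + ∑ Y ∈ s.1, ag.Rτ Y * ag.M𝒪 Y))
              ≤ Real.exp wm ∧
          (2 * (ι.θ * (((𝔇 K k).𝒦 Z s).m * (1 + 2 / ι.kap'') ^ (𝔇 K k).ν)) + (ι.γ₂ + am)) * ι.cE ≤ 1 / 2 ∧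
          (2 * (ι.θ * (((𝔇 K k).𝒦 Z s).m * (1 + 2 / ι.kap'') ^ (𝔇 K k).ν)) + (ι.γ₂ + am)) * (1 + 2 * ι.cE * ι.g) ≤ 1 / 2 ∧
          2 * (ι.K₀ * (((𝔇 K k).𝒦 Z s).m * (1 + 2 / ι.kap) ^ (𝔇 K k).ν) * (ι.θ * (((𝔇 K k).𝒦 Z s).m * (1 + 2 / ι.kap'') ^ (𝔇 K k).ν))
              * (1 + (1 - ι.K₀ * (((𝔇 K k).𝒦 Z s).m * (1 + 2 / ι.kap) ^ (𝔇 K k).ν) * (ι.θ * (((𝔇 K k).𝒦 Z s).m * (1 + 2 / ι.kap'') ^ (𝔇 K k).ν)))⁻¹) / 2)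
              * (Fintype.card ((𝔇 K k).𝒦 Z s).Λ : ℝ)
            + wm + (2 * (ι.θ * (((𝔇 K k).𝒦 Z s).m * (1 + 2 / ι.kap'') ^ (𝔇 K k).ν)) + (ι.γ₂ + am)) * ι.cE * (Fintype.card ((𝔇 K k).𝒦 Z s).Λ : ℝ)
            + (2 * (ι.θ * (((𝔇 K k).𝒦 Z s).m * (1 + 2 / ι.kap'') ^ (𝔇 K k).ν)) + (ι.γ₂ + am)) * (1 + 2 * ι.cE * ι.g)
              * (Fintype.card (((𝔇 K k).𝒦 Z s).Λ ⊕ ((𝔇 K k).𝒦 Z s).C₀) : ℝ)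
            ≤ 2 * ((Z.1).card : ℝ) ∧
          (s.2.card = 0 → ∃ κb Rb T : ℝ, 0 ≤ κb ∧ κb ≤ ι.γ₂ + am ∧
            (∀ B : ((𝔇 K k).𝒦 Z s).Λ → ℝ, B ⬝ᵥ B < Rb ^ 2 → χu K k Z s (t • B) * χcu K k Z s (t • B) = 1) ∧
            Real.exp (-(κb / 2 * Rb ^ 2)) ≤ T * t ^ 2 ∧ 1 + T ≤ Mv) ∧
          (s.2.card ≠ 0 → ∃ r₁' T' : ℝ, r₁' ^ 2 ≤ ι.rP ^ 2 ∧ a ≤ ι.γ₂ * r₁' ^ 2 ∧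
            Real.exp (-(ι.γ₂ / 2 * (ι.rP ^ 2 - r₁' ^ 2))) ≤ T' * t ^ 2 ∧ T' ≤ Mv)) := by
  have h := fun (K k : ℕ) => locatedLemma2Records_inhabited c (F.P K) 𝔸 M k L hκ₁ hE hε hC₁ hα hMc hδκ hpref γ a hMv
  choose 𝔇 χu χcu 𝒲 𝒪 hlaw hBox hχ1 hfam using h
  refine ⟨𝔇, χu, χcu, 𝒲, 𝒪, fun K k => hlaw K k, fun K k => hBox K k, fun K k => hχ1 K k, ?_⟩
  intro K k old _ X φ _ Z _ s _ t ht
  exact hfam K k Z (Finset.one_le_card.2 Z.2.1) s old φ t ht.1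

/-! ## §2 ★ J88 ∕ J81r: the same with the located family in the LOCAL-GROWTH currency -/

open Classical in
/-- ★ **THE DATUM-SIDE BINDERS `hlaw ∧ hBox ∧ hχ1 ∧ hιc` OF THE LOCAL-GROWTH-CURRENCY SOCKETS (J88 ∕ J81r) ARE JOINTLY INHABITED, AS STATED** — the §1 statement with
J88's located family (binder `hιc` verbatim at `ρ_b = 1∕12`, `a₅ = 2`: ONE `Inputs226Holo` record, ONE `LocalGrowthInputs` record and the rows (r1)–(r6) in the local
growth letters) — J88-W §2 step by step.  A6 witness at degenerate data; nothing of print's.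
[cite: Balaban1988RG2Cluster, (2.3) p.12, (2.14) p.15 and (2.22) p.16 (degenerate data; bookkeeping)] -/
theorem socketFamilies_inhabited_localGrowth (hκ₁ : 1 ≤ c.κ₁) (hE : 0 < c.E₀) (hε : 0 < c.ε₁) (hC₁ : 0 < c.C₁) (hα : 0 < c.α₄) (hMc : 0 < c.M)
    (hδκ : 0 ≤ (1 - 3 * c.δ) * c.κ) (hpref : c.E₀ * c.ε₁ * c.C₁ * c.α₄⁻¹ * c.M ^ c.q * Real.exp (c.C₂ * c.κ₁) ≤ 1 / 2)
    (sp : (K j : ℕ) → (domSys (F.P K) M j).Dom → Set (CPair (F.P K) 𝔸)) (E₀ r₁ γ a : ℝ) {Mv : ℝ} (hMv : 1 < Mv) :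
    ∃ (𝔇 : (K : ℕ) → TermData214 c (F.P K) 𝔸 M L) (χu χcu : (K k : ℕ) → (𝔇 K k).UnscaledChi) (𝒲 : (K k : ℕ) → (𝔇 K k).UnscaledWilson)
      (𝒪 : (K k : ℕ) → (𝔇 K k).UnscaledOlder),
      (∀ K, (𝔇 K).UnscaledFieldLawOn (χu K) (χcu K) (𝒲 K) (𝒪 K) γ) ∧
      (∀ (K k : ℕ) (Z : (domSys (F.P K) M (k + 1)).Dom) (s : TermLabel (F.P K) M k L), (𝔇 K k).UnscaledBoxLaws (χu K k) (χcu K k) Z s) ∧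
      (∀ (K k : ℕ) (Z : (domSys (F.P K) M (k + 1)).Dom) (s : TermLabel (F.P K) M k L) (A : ((𝔇 K k).𝒦 Z s).Λ → ℝ), χu K k Z s A * χcu K k Z s A ≤ 1) ∧
      (∀ (K k : ℕ) (old : OlderTerms (F.P K) 𝔸 M k), old ∈ AdmHist (sp K) E₀ r₁ k ∧ old 0 = 0 → ∀ (X : (domSys (F.P K) M (k + 1)).Dom), ∀ φ ∈ sp K (k + 1) X,
      ∀ Z : (domSys (F.P K) M (k + 1)).Dom, Subtype.val Z ⊆ Subtype.val X → ∀ s ∈ terms L M Z, ∀ t ∈ Ioc (0 : ℝ) γ,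
        ∃ ι : (𝔇 K k).Inputs226Holo c Z s ((t : ℝ) : ℂ) old φ a 2, ∃ lg : (𝔇 K k).LocalGrowthInputs (χu K k) (𝒲 K k) (𝒪 K k) Z s old φ ι.Uτ,
        ∃ KE KG' KCs' θΓ' θC' θE' am wm δ : ℝ,
          0 ≤ KE ∧
          (∀ b b', ‖(((𝔇 K k).𝒦 Z s).C⁻¹.map (algebraMap ℝ ℂ)) b b'‖ ≤
            KE * Real.exp (-(ι.kap * tdist1 (𝔇 K k).Nf (((𝔇 K k).𝒦 Z s).locΛ b) (((𝔇 K k).𝒦 Z s).locΛ b')))) ∧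
          (1 + (1 / 12 : ℝ)) * ι.KG ≤ KG' ∧ ((1 - (1 / 12 : ℝ)) ^ 2)⁻¹ * ι.KCs ≤ KCs' ∧ ι.θΓ + (1 / 12 : ℝ) * ι.KG ≤ θΓ' ∧
          ι.θC + (1 / 12 : ℝ) * (2 + (1 / 12 : ℝ)) * ((1 - (1 / 12 : ℝ)) ^ 2)⁻¹ * ι.KCs ≤ θC' ∧ ι.θE + (1 / 12 : ℝ) * (2 + (1 / 12 : ℝ)) * (ι.θE + KE) ≤ θE' ∧ θE' ≤ ι.θ ∧ θΓ' ≤ ι.θ ∧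
          ((((𝔇 K k).𝒦 Z s).m * (1 + 2 / (ι.kap - ι.kap')) ^ (𝔇 K k).ν) * (((𝔇 K k).𝒦 Z s).m * (1 + 2 / (ι.kap' - ι.kap'')) ^ (𝔇 K k).ν)
            * (θΓ' * KCs' * KG' + ι.KΓ * θC' * KG' + ι.KΓ * ι.K₀ * θΓ') ≤ ι.θ) ∧
          (1 + (1 / 12 : ℝ)) ^ 2 * (2 * lg.ρ * lg.m₃) ≤ am ∧ (1 + (1 / 12 : ℝ)) ^ 2 * (∑ Y ∈ s.1, lg.R Y * (lg.c₀ Y + lg.c₁ Y * lg.ρ)) ≤ wm ∧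
          0 < δ ∧ 2 * δ + 8 * lg.ρ * lg.m₃ ≤ am ∧
          Real.exp (∑ Y ∈ s.1, lg.R Y * lg.c₀ Y)
              * ((∑ Y ∈ s.1, lg.R Y * ((4 * lg.c₄ Y + (4 * lg.c₃ Y + 4 * lg.c₃' Y) / lg.ρ) * (4 / (Real.exp 1 * δ)) ^ 4
                    + (lg.c₂ Y + (lg.c₁ Y + lg.c₁' Y) / lg.ρ) * (2 / (Real.exp 1 * δ)) ^ 2)) * Real.exp (δ / 2)
                 + ((∑ Y ∈ s.1, lg.R Y * (4 * lg.c₃ Y * (3 / (Real.exp 1 * δ)) ^ 3 + lg.c₁ Y * (1 / (Real.exp 1 * δ))))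
                      * Real.exp (δ / 2)) ^ 2
                    * Real.exp ((∑ Y ∈ s.1, lg.R Y * (lg.c₀ Y + lg.c₁ Y * lg.ρ)) + ∑ Y ∈ s.1, lg.R Y * lg.c₀ Y))
              ≤ Real.exp wm ∧
          (2 * (ι.θ * (((𝔇 K k).𝒦 Z s).m * (1 + 2 / ι.kap'') ^ (𝔇 K k).ν)) + (ι.γ₂ + am)) * ι.cE ≤ 1 / 2 ∧
          (2 * (ι.θ * (((𝔇 K k).𝒦 Z s).m * (1 + 2 / ι.kap'') ^ (𝔇 K k).ν)) + (ι.γ₂ + am)) * (1 + 2 * ι.cE * ι.g) ≤ 1 / 2 ∧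
          2 * (ι.K₀ * (((𝔇 K k).𝒦 Z s).m * (1 + 2 / ι.kap) ^ (𝔇 K k).ν) * (ι.θ * (((𝔇 K k).𝒦 Z s).m * (1 + 2 / ι.kap'') ^ (𝔇 K k).ν))
              * (1 + (1 - ι.K₀ * (((𝔇 K k).𝒦 Z s).m * (1 + 2 / ι.kap) ^ (𝔇 K k).ν) * (ι.θ * (((𝔇 K k).𝒦 Z s).m * (1 + 2 / ι.kap'') ^ (𝔇 K k).ν)))⁻¹) / 2)
              * (Fintype.card ((𝔇 K k).𝒦 Z s).Λ : ℝ)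
            + wm + (2 * (ι.θ * (((𝔇 K k).𝒦 Z s).m * (1 + 2 / ι.kap'') ^ (𝔇 K k).ν)) + (ι.γ₂ + am)) * ι.cE * (Fintype.card ((𝔇 K k).𝒦 Z s).Λ : ℝ)
            + (2 * (ι.θ * (((𝔇 K k).𝒦 Z s).m * (1 + 2 / ι.kap'') ^ (𝔇 K k).ν)) + (ι.γ₂ + am)) * (1 + 2 * ι.cE * ι.g)
              * (Fintype.card (((𝔇 K k).𝒦 Z s).Λ ⊕ ((𝔇 K k).𝒦 Z s).C₀) : ℝ)
            ≤ 2 * ((Z.1).card : ℝ) ∧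
          (s.2.card = 0 → ∃ κb Rb T : ℝ, 0 ≤ κb ∧ κb ≤ ι.γ₂ + am ∧
            (∀ B : ((𝔇 K k).𝒦 Z s).Λ → ℝ, B ⬝ᵥ B < Rb ^ 2 → χu K k Z s (t • B) * χcu K k Z s (t • B) = 1) ∧
            Real.exp (-(κb / 2 * Rb ^ 2)) ≤ T * t ^ 2 ∧ 1 + T ≤ Mv) ∧
          (s.2.card ≠ 0 → ∃ r₁' T' : ℝ, r₁' ^ 2 ≤ ι.rP ^ 2 ∧ a ≤ ι.γ₂ * r₁' ^ 2 ∧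
            Real.exp (-(ι.γ₂ / 2 * (ι.rP ^ 2 - r₁' ^ 2))) ≤ T' * t ^ 2 ∧ T' ≤ Mv)) := by
  have h := fun (K k : ℕ) => locatedRecords_inhabited c (F.P K) 𝔸 M k L hκ₁ hE hε hC₁ hα hMc hδκ hpref γ a hMv
  choose 𝔇 χu χcu 𝒲 𝒪 hlaw hBox hχ1 hfam using h
  refine ⟨𝔇, χu, χcu, 𝒲, 𝒪, fun K k => hlaw K k, fun K k => hBox K k, fun K k => hχ1 K k, ?_⟩
  intro K k old _ X φ _ Z _ s _ t ht
  exact hfam K k Z (Finset.one_le_card.2 Z.2.1) s old φ t ht.1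

end YMDAG.N22.W1

end
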